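import Summits.MatrixMultiplication.OmegaCensus.DominoStructure
import HarnessLib

/-!
# The Radon (line-projection) identity for the reduced domino problem

ω-census `pub-omega`, family (b3), seat pub-omega-group gen 7.  Framing: lottery ticket; floor = certified bounds/negative
ranges.  VALUE: the kernel form of the necessary condition behind the cell's 'Radon filter' certificates
(`THEORY-radon-g7.md` R2); NOT progress on ω.

Setting: a finite abelian group `A`, a homomorphism `φ : A →+ B` to a finite abelian group (a 'projection'; in the census
`B = ZMod p` and `φ` is one of the `p+1` line maps of `A = (ZMod p)²`, or a cyclic quotient of `A`), finite sets
`X, Y ⊆ A` whose sumset `X + Y` is DIRECT (all sums distinct), and the fibre counts `n_X(t) = |X ∩ φ⁻¹(t)|`.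

* `card_fibre_sumset`:  `|(X+Y) ∩ φ⁻¹(t)| = Σ_u n_X(t−u) n_Y(u)`;
* `card_fibre_diffset`: `|(Y−X) ∩ φ⁻¹(t)| = Σ_u n_X(u−t) n_Y(u)`;
* `card_fibre_diffset'`: `|(X−Y) ∩ φ⁻¹(t)| = Σ_u n_X(t+u) n_Y(u)`;
* **`radon_identity`**: if the three sets `X+Y`, `Y−X`, `X−Y` are pairwise disjoint and together with a point `x₀` cover
  `A`, then for every `t ∈ B`
  `Σ_u (n_X(t−u) + n_X(u−t) + n_X(t+u)) · n_Y(u) + [φ x₀ = t] = |φ⁻¹(t)|`.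
This is identity (L) of the Radon engine (with `|φ⁻¹(t)| = p` for a line map of `(ZMod p)²`): every solution of the
symmetric reduced problem `(X+Y) ⊔ (Y−X) ⊔ (X−Y) = A ∖ {x₀}` (to which every law-attaining domino TPP triple over an
odd-order `A` reduces, `DominoStructureTPP.domino_structure_of_law` + the vertex packing) has ADMISSIBLE fibre-count
vectors in every projection; the engine enumerates the admissible vectors exactly and finds no subset of `(ZMod p)²`
admissible in all `p+1` directions (p = 7, 11, 13, 17, 19).
-/

namespace Summit.MatrixMultiplication.OmegaCensus

open Finset

section Radon

variable {A B : Type*} [AddCommGroup A] [DecidableEq A] [AddCommGroup B] [Fintype B] [DecidableEq B]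

omit [Fintype B] in
/-- The fibre of an injective image is the image of the fibre. [folklore] -/
theorem card_filter_image_of_injOn (φ : A →+ B) {S : Finset (A × A)} {g : A × A → A}
    (hg : Set.InjOn g ↑S) (t : B) :
    ((S.image g).filter fun a => φ a = t).card = (S.filter fun p => φ (g p) = t).card := by
  rw [filter_image, card_image_of_injOn (hg.mono (by intro p hp; exact (mem_filter.1 (mem_coe.1 hp)).1))]

omit [DecidableEq A] in
/-- Fibre counting of a set of pairs by the value of `φ` on the second coordinate. [folklore] -/
theorem card_filter_pairs_eq_sum (φ : A →+ B) (X Y : Finset A) (P : A → A → Prop) [DecidablePred fun p : A × A => P p.1 p.2]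
    (r : B → B) (hP : ∀ x y, P x y ↔ φ x = r (φ y)) :
    ((X ×ˢ Y).filter fun p : A × A => P p.1 p.2).card = ∑ u : B, (X.filter fun a => φ a = (r u)).card * (Y.filter fun a => φ a = u).card := by
  rw [card_eq_sum_card_fiberwise (f := fun p : A × A => φ p.2) (t := (univ : Finset B)) (fun _ _ => mem_univ _)]
  refine sum_congr rfl fun u _ => ?_
  have : ((X ×ˢ Y).filter fun p : A × A => P p.1 p.2).filter (fun p : A × A => φ p.2 = u) =
      (X.filter fun a => φ a = r u) ×ˢ (Y.filter fun a => φ a = u) := by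
    ext ⟨x, y⟩
    simp only [mem_filter, mem_product, hP]
    constructor
    · rintro ⟨⟨⟨hx, hy⟩, hxy⟩, hu⟩
      exact ⟨⟨hx, by rw [hxy, hu]⟩, hy, hu⟩
    · rintro ⟨⟨hx, hxu⟩, hy, hu⟩
      exact ⟨⟨⟨hx, hy⟩, by rw [hxu, hu]⟩, hu⟩
  rw [this, card_product]

/-- **Fibres of a direct sumset**: `|(X+Y) ∩ φ⁻¹(t)| = Σ_u n_X(t−u)·n_Y(u)`. [folklore] -/
theorem card_fibre_sumset (φ : A →+ B) {X Y : Finset A}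
    (hinj : Set.InjOn (fun p : A × A => p.1 + p.2) ↑(X ×ˢ Y)) (t : B) :
    (((X ×ˢ Y).image fun p : A × A => p.1 + p.2).filter fun a => φ a = t).card =
      ∑ u : B, (X.filter fun a => φ a = (t - u)).card * (Y.filter fun a => φ a = u).card := by
  rw [card_filter_image_of_injOn φ hinj t]
  exact card_filter_pairs_eq_sum φ X Y (fun x y => φ (x + y) = t) (fun u => t - u)
    (fun x y => by rw [map_add]; constructor <;> intro h <;> [rw [← h, add_sub_cancel_right]; rw [h, sub_add_cancel]])

omit [DecidableEq A] [Fintype B] [DecidableEq B] in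
/-- Directness of `X + Y` gives directness of `X − Y`. [folklore] -/
theorem injOn_diff_of_injOn_sum' {X Y : Finset A} (hinj : Set.InjOn (fun p : A × A => p.1 + p.2) ↑(X ×ˢ Y)) :
    Set.InjOn (fun p : A × A => p.1 - p.2) ↑(X ×ˢ Y) := by
  rintro ⟨x, y⟩ h ⟨x', y'⟩ h' he
  simp only [coe_product, Set.mem_prod, mem_coe] at h h'
  change x - y = x' - y' at he
  have key : x + y' = x' + y := by
    calc x + y' = x - y + y + y' := by abel
      _ = x' - y' + y + y' := by rw [he]
      _ = x' + y := by abel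
  have hm : (x, y') ∈ (↑(X ×ˢ Y) : Set (A × A)) := by simp [h.1, h'.2]
  have hm' : (x', y) ∈ (↑(X ×ˢ Y) : Set (A × A)) := by simp [h'.1, h.2]
  have := hinj hm hm' key
  simp only [Prod.mk.injEq] at this
  obtain ⟨hx, hy⟩ := this
  rw [hx, hy]

/-- **Fibres of the direct difference set `Y − X`**: `|(Y−X) ∩ φ⁻¹(t)| = Σ_u n_X(u−t)·n_Y(u)`. [folklore] -/
theorem card_fibre_diffset (φ : A →+ B) {X Y : Finset A}
    (hinj : Set.InjOn (fun p : A × A => p.1 + p.2) ↑(X ×ˢ Y)) (t : B) :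
    (((Y ×ˢ X).image fun p : A × A => p.1 - p.2).filter fun a => φ a = t).card =
      ∑ u : B, (X.filter fun a => φ a = (u - t)).card * (Y.filter fun a => φ a = u).card := by
  rw [card_filter_image_of_injOn φ (injOn_diff_of_injOn_sum hinj) t]
  -- swap the factors to apply the pair-counting lemma with `X` first
  have hswap : ((Y ×ˢ X).filter fun p : A × A => φ (p.1 - p.2) = t).card =
      ((X ×ˢ Y).filter fun p : A × A => φ (p.2 - p.1) = t).card := by
    refine card_bij (fun p _ => (p.2, p.1)) ?_ ?_ ?_
    · rintro ⟨y, x⟩ hp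
      simp only [mem_filter, mem_product] at hp ⊢
      exact ⟨⟨hp.1.2, hp.1.1⟩, hp.2⟩
    · rintro ⟨y, x⟩ _ ⟨y', x'⟩ _ h
      simp only [Prod.mk.injEq] at h ⊢
      exact ⟨h.2, h.1⟩
    · rintro ⟨x, y⟩ hp
      refine ⟨(y, x), ?_, rfl⟩
      simp only [mem_filter, mem_product] at hp ⊢
      exact ⟨⟨hp.1.2, hp.1.1⟩, hp.2⟩
  rw [hswap]
  exact card_filter_pairs_eq_sum φ X Y (fun x y => φ (y - x) = t) (fun u => u - t)
    (fun x y => by rw [map_sub]; constructor <;> intro h <;> [rw [← h, sub_sub_cancel]; rw [h, sub_sub_cancel]])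

/-- **Fibres of the direct difference set `X − Y`**: `|(X−Y) ∩ φ⁻¹(t)| = Σ_u n_X(t+u)·n_Y(u)`. [folklore] -/
theorem card_fibre_diffset' (φ : A →+ B) {X Y : Finset A}
    (hinj : Set.InjOn (fun p : A × A => p.1 + p.2) ↑(X ×ˢ Y)) (t : B) :
    (((X ×ˢ Y).image fun p : A × A => p.1 - p.2).filter fun a => φ a = t).card =
      ∑ u : B, (X.filter fun a => φ a = (t + u)).card * (Y.filter fun a => φ a = u).card := by
  rw [card_filter_image_of_injOn φ (injOn_diff_of_injOn_sum' hinj) t]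
  exact card_filter_pairs_eq_sum φ X Y (fun x y => φ (x - y) = t) (fun u => t + u)
    (fun x y => by rw [map_sub]; constructor <;> intro h <;> [rw [← h, sub_add_cancel]; rw [h, add_sub_cancel_right]])

variable [Fintype A]

/-- **The Radon identity (L).**  If the direct sumset `X + Y` and the difference sets `Y − X`, `X − Y` are pairwise
disjoint and, together with one point `x₀`, cover `A`, then for every `t`:
`Σ_u (n_X(t−u) + n_X(u−t) + n_X(t+u)) · n_Y(u) + [φ x₀ = t] = |φ⁻¹(t)|`. [folklore] -/
theorem radon_identity (φ : A →+ B) {X Y : Finset A} {x₀ : A}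
    (hinj : Set.InjOn (fun p : A × A => p.1 + p.2) ↑(X ×ˢ Y))
    (hPQ : Disjoint ((X ×ˢ Y).image fun p : A × A => p.1 + p.2) ((Y ×ˢ X).image fun p : A × A => p.1 - p.2))
    (hPR : Disjoint ((X ×ˢ Y).image fun p : A × A => p.1 + p.2) ((X ×ˢ Y).image fun p : A × A => p.1 - p.2))
    (hQR : Disjoint ((Y ×ˢ X).image fun p : A × A => p.1 - p.2) ((X ×ˢ Y).image fun p : A × A => p.1 - p.2))
    (hcover : ((X ×ˢ Y).image fun p : A × A => p.1 + p.2) ∪ ((Y ×ˢ X).image fun p : A × A => p.1 - p.2) ∪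
      ((X ×ˢ Y).image fun p : A × A => p.1 - p.2) = univ.erase x₀) (t : B) :
    (∑ u : B, ((X.filter fun a => φ a = (t - u)).card + (X.filter fun a => φ a = (u - t)).card + (X.filter fun a => φ a = (t + u)).card) * (Y.filter fun a => φ a = u).card) +
      (if φ x₀ = t then 1 else 0) = (univ.filter fun a : A => φ a = t).card := by
  set P := (X ×ˢ Y).image fun p : A × A => p.1 + p.2
  set Q := (Y ×ˢ X).image fun p : A × A => p.1 - p.2
  set R := (X ×ˢ Y).image fun p : A × A => p.1 - p.2
  have hsum : (∑ u : B, ((X.filter fun a => φ a = (t - u)).card + (X.filter fun a => φ a = (u - t)).card + (X.filter fun a => φ a = (t + u)).card) * (Y.filter fun a => φ a = u).card) =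
      (P.filter fun a => φ a = t).card + (Q.filter fun a => φ a = t).card + (R.filter fun a => φ a = t).card := by
    rw [card_fibre_sumset φ hinj, card_fibre_diffset φ hinj, card_fibre_diffset' φ hinj, ← sum_add_distrib,
      ← sum_add_distrib]
    exact sum_congr rfl fun u _ => by ring
  rw [hsum]
  -- the fibre of `t` in `A` splits along the partition `P ⊔ Q ⊔ R ⊔ {x₀}`
  have hdPQ : Disjoint (P.filter fun a => φ a = t) (Q.filter fun a => φ a = t) := disjoint_filter_filter hPQ
  have hdPR : Disjoint (P.filter fun a => φ a = t) (R.filter fun a => φ a = t) := disjoint_filter_filter hPR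
  have hdQR : Disjoint (Q.filter fun a => φ a = t) (R.filter fun a => φ a = t) := disjoint_filter_filter hQR
  have hunion : (univ.filter fun a : A => φ a = t) =
      ((P ∪ Q ∪ R).filter fun a => φ a = t) ∪ (({x₀} : Finset A).filter fun a => φ a = t) := by
    rw [← filter_union, hcover]
    congr 1
    ext a
    simp only [mem_union, mem_erase, mem_univ, mem_singleton, and_true]
    tauto
  have hdisj0 : Disjoint ((P ∪ Q ∪ R).filter fun a => φ a = t) (({x₀} : Finset A).filter fun a => φ a = t) := by
    apply disjoint_filter_filter
    rw [hcover, disjoint_singleton_right]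
    exact fun h => (mem_erase.1 h).1 rfl
  rw [hunion, card_union_of_disjoint hdisj0, filter_union, filter_union,
    card_union_of_disjoint (disjoint_union_left.2 ⟨hdPR, hdQR⟩), card_union_of_disjoint hdPQ]
  congr 1
  rw [filter_singleton]
  split_ifs <;> simp

end Radon

end Summit.MatrixMultiplication.OmegaCensus
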